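import Literature.AnabelianGeometry.EtaleTheta.Discharge.Sec3OfGaloisCoveringConnectedRealified
import Literature.AnabelianGeometry.EtaleTheta.Discharge.Sec3Thm37UnitsWeak
import HarnessLib

/-!
# [EtTh] Theorem 3.7 (iv) «`D` slim, `Λ ∈ {ℤ, ℝ}` ⟹ `C` slim» — END KNIT: the `Λ = ℤ` input of record `hP34` REPLACED
# by Prop. 3.2 (iii); the node AS TYPED (`TemperedFrobenioid.Thm37_iv`) with NO binder at the genuine data (proof-only)

S. Mochizuki, *The étale theta function and its Frobenioid-theoretic manifestations*, Publ. RIMS **45** (2009)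
[MochizukiEtTh2009], §3: Thm. 3.7 (iv), printed p. 306 (PDF p. 80) l. 7, proof ll. 23–25 («Assertion (iv) follows
formally from [Mzk17], Proposition 1.13, (iii) [since … "condition (b)" of loc. cit. is always satisfied by objects
of `C`]»); Prop. 3.2 (iii), printed p. 296 (PDF p. 70) («Let `f` be a nonzero meromorphic function on `Z_∞` such
that for every `N ∈ ℕ_{≥1}`, there exists a meromorphic function `g_N` on `Z_∞` such that `g_N^N = f`.  Then
`f = 1`.»); Def. 3.3 (iii) PDF p. 73 (`B₀(Y) ⊆ Mero(Z_∞)`); [MochizukiFrdI2008] Prop. 1.13 (iii) p. 31 (condition (b)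
«`⋂ₙ O^×(A)ⁿ = 1`»), Thm. 5.2 (ii) p. 100. [cite: MochizukiEtTh2009, Thm 3.7 (iv) p.80]
[cite: MochizukiEtTh2009, Prop 3.2 (iii) p.70]

abc-iut cell, layer L2, cone node **`EtTh:Thm3.7(iv)`** (`N_EtTh_Thm3_7_iv`), seat abc-iut-w5-d246 (gen 8).  PROOF-ONLY
(0 `def`s, no `Prop` facts, no instances); nothing landed is edited or restated, every input consumed BY NAME
(abc-iut-L2-t3's typed node `TemperedFrobenioid.Thm37_iv`; `Sec3Thm37Holds` = [FrdI] Prop. 1.13 (iii) via L1's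
`PreFrobenioid.isSlim`; L1's `ModelFrobenioid.unitsToRatFn[_injective]`, `divB_unitsToRatFn_eq_one`; abc-iut-w6-d058's
genuine Def. 3.3 (iii) records `DivisorMonoids.ofGaloisAction[Connected]`; the Def. 3.6 (i) constructors
`RealifiedDivisorMonoids.ofRlfZ[Weak]` / `ofRlfR[Weak]`; `Sec3OfGaloisCoveringConnectedRealified` (abc-iut-w5-d179),
`Sec3BLambdaInjectiveOfGaloisCoveringConnected` (abc-iut-w6-d048), `Sec3Thm37Units[Weak]` (abc-iut-L6-t13 / L2-t6)).

BEFORE THIS FILE (`Sec3Thm37ivNode`, abc-iut-w4-d103; `Sec3OfGaloisCoveringConnectedRealified`): the (iv) closers carry,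
for `Λ = ℤ`, the Prop. 3.4 (ii) input `hP34 : ∀ A, ∃ L p-adic local, Ker(B₀(Y_A)^× → (Φ₀^ℝ)^gp) ≃* O_L^×`, used only to
get condition (b) of [FrdI] Prop. 1.13 (iii) «no non-trivial divisible unit» from the topology of `O_L^×`; at the genuine
Def. 3.3 (iii) data of the connected coverings over `B^temp(Π)⁰`, «`C` slim» was UNCONDITIONAL for `Λ = ℝ` but «⇐ {`Π`
tempered, temp-slim, `hP34`}» for `Λ = ℤ`.

THIS FILE.  §1 (any data, any vocabulary) `hdiv_of_BΛ_eq_one_of_divisible`: condition (b) ⟸ «`C` Frobenioid» + «`B₀^Λ(Y_A)`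
has no non-trivial infinitely divisible element» (the `B₀^Λ`-component of `u_σ`, `σ ∈ O^×(A)`, is a multiplicative
injective invariant with `Div_B(u_σ) = 0`); whence «`C` slim» and `Thm37_iv` modulo {`hF`, that clause} / {`hBmon`, that
clause}.  §2 `bZero_eq_one_of_forall_exists_pow_eq`: **Prop. 3.2 (iii) ⟹ `B₀(S) = Hom_G(S, Mero(Z_∞))` has no
non-trivial infinitely divisible element** (pointwise).  §3 `Λ = ℤ`, constructed data `ofRlfZ` / `ofRlfZWeak` of the
connected coverings (`B₀^ℤ := B₀`), ANY base: condition (b), «`C` slim ⇐ `D` slim», `Thm37_iv` modulo `hF` only / `hBmon`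
only / «`D` of FSM-type» only; **genuine base `B^temp(Π)⁰`: `Thm37_iv` with NO binder; «`C` slim» ⇐ {`Π` tempered,
temp-slim} ONLY; UNCONDITIONAL at `Π = Π^tp_X`** — `hP34` GONE from (iv).  §4 `Λ = ℝ` (`ofRlfR[Weak]`), genuine base:
`Thm37_iv` with NO binder (one-line compositions).  Net: `C₀.Thm37_iv` is a THEOREM WITH NO HYPOTHESIS at the genuine
Def. 3.3 (iii) data of the connected coverings over `B^temp(Π)⁰` for ALL FOUR Def. 3.6 (i) constructors of print's
casing `Λ ∈ {ℤ, ℝ}`.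

HONEST FRAMING: refereed pre-IUT material; every theorem is an implication for data so parametrised (`LogDivisorModel` /
`GaloisAction` / `CuspLaws` are interface and parameter records — nothing asserts they arise from an actual curve); the
`Λ = ℤ` route «Prop. 3.2 (iii) ⟹ condition (b)» by-passes print's «by assertion (i)» through print's own Prop. 3.2 (iii)
(the fact underlying (i)) and strengthens no statement of [EtTh]; nothing here bears on the disputed [IUTchIII]
Cor. 3.12; typed ≠ proved — here PROVED.
-/

noncomputable section

namespace Literature.AnabelianGeometry.EtaleTheta

open CategoryTheory Opposite Function Literature.AlgebraicGeometry.Frobenioids Literature.AnabelianGeometry.SemiGraphs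

universe u₀ v₀ u v w u' v'

namespace TemperedFrobenioid

section General

variable {D₀ : Type u₀} [Category.{v₀} D₀] {V : FrdIMonoidStub.{w}}
  {T : RealifiedDivisorMonoids (D₀ := D₀) V} {D : Type u} [Category.{v} D]
  {VD : FrdICatStub.{u, v, w} D} (C₀ : TemperedFrobenioid T D VD)

/-- **Condition (b) of [FrdI] Prop. 1.13 (iii) for a tempered Frobenioid** («a unit `σ ∈ O^×(A)` admitting `n`-th
roots in `O^×(A)` for every `n ≥ 1` is trivial») ⟸ «`C` is a Frobenioid» ([FrdI] Thm. 5.2 (ii), `hF`) + «for every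
`A ∈ Ob(D)` the group-like monoid `B₀^Λ(Y_A)` has no non-trivial infinitely divisible element» (`hB`).  Proof: the
`B₀^Λ(Y_A)`-component of the rational function `u_σ ∈ B(A_D) = B₀^Λ(Y_A) ×_{(Φ^{ℝ-log})^gp} Φ(A_D)^gp` of a unit is
multiplicative and (with `Div_B(u_σ) = 0`, `Φ(A_D)` sharp) determines `σ` (L1's `ModelFrobenioid.unitsToRatFn_injective`,
`Φ(A_D)` integral); roots of `σ` in `O^×(A)` give roots of that component in `B₀^Λ(Y_A)`.
[cite: MochizukiEtTh2009, Thm 3.7 (iv) p.80] [cite: MochizukiFrdI2008, Prop 1.13 (iii) p.31] -/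
theorem hdiv_of_BΛ_eq_one_of_divisible (hF : PreFrobenioid.IsFrobenioid C₀.toElem)
    (hB : ∀ (A : Dᵒᵖ) (b : T.BΛ.obj (C₀.baseOp A)),
      (∀ n : ℕ+, ∃ c : T.BΛ.obj (C₀.baseOp A), c ^ (n : ℕ) = b) → b = 1) :
    ∀ (X : C₀.category) (α : Aut X), α ∈ PreFrobenioid.unitsSubgroup C₀.toElem X →
      (∀ n : ℕ+, ∃ β : Aut X, β ∈ PreFrobenioid.unitsSubgroup C₀.toElem X ∧ β ^ (n : ℕ) = α) → α = 1 := by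
  intro X α hα hroots
  have hΦ : IsDivisorial (C₀.divisorMonoid.obj (op X.base)) := hF.isPreFrobenioid.isDivisorial X.base
  -- the `B₀^Λ(Y_A)`-component of a rational function on `A_D`, a homomorphism of monoids
  let π : (C₀.ratFnFunctor.obj (op X.base)) →* T.BΛ.obj (C₀.baseOp (op X.base)) :=
    (MonoidHom.fst _ _).comp (C₀.ratFn (op X.base)).subtype
  let a : ModelFrobenioid.units X := ⟨α, hα⟩
  set p : C₀.ratFn (op X.base) :=
    (ModelFrobenioid.unitsToRatFn X a : C₀.ratFnFunctor.obj (op X.base)) with hp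
  have h1 : Literature.AlgebraicGeometry.Frobenioids.divB C₀.divisorMonoid C₀.ratFnFunctor C₀.divBNatTrans (op X.base)
      (ModelFrobenioid.unitsToRatFn X a : C₀.ratFnFunctor.obj (op X.base)) = 1 :=
    ModelFrobenioid.divB_unitsToRatFn_eq_one hΦ.isSharp a
  have h2 : p.1.2 = 1 := h1
  have h3 : p.1.1 = 1 := by
    refine hB (op X.base) p.1.1 fun n => ?_
    obtain ⟨β, hβ, hβn⟩ := hroots n
    let b : ModelFrobenioid.units X := ⟨β, hβ⟩
    have hbn : b ^ (n : ℕ) = a := Subtype.ext (by rw [Subgroup.coe_pow]; exact hβn)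
    have e1 : (ModelFrobenioid.unitsToRatFn X b) ^ (n : ℕ) = ModelFrobenioid.unitsToRatFn X a := by
      rw [← map_pow, hbn]
    have e2 : (ModelFrobenioid.unitsToRatFn X b : C₀.ratFnFunctor.obj (op X.base)) ^ (n : ℕ) = p := by
      rw [← Units.val_pow_eq_pow_val, e1]
    refine ⟨π (ModelFrobenioid.unitsToRatFn X b : C₀.ratFnFunctor.obj (op X.base)), ?_⟩
    change π _ ^ (n : ℕ) = π p
    rw [← map_pow, e2]
  have h4 : p = 1 := Subtype.ext (Prod.ext h3 h2)
  have h5 : ModelFrobenioid.unitsToRatFn X a = 1 := Units.val_eq_one.mp h4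
  have h6 : a = 1 :=
    ModelFrobenioid.unitsToRatFn_injective hΦ.isPreDivisorial.isIntegral (by rw [h5, map_one])
  exact congrArg Subtype.val h6

/-- **[EtTh] Thm. 3.7 (iv), «`C` is slim»** ⟸ {`hF` ([FrdI] Thm. 5.2 (ii)), «`B₀^Λ(Y_A)` has no non-trivial infinitely
divisible element», «`D` slim»} — [FrdI] Prop. 1.13 (iii) with condition (b) from `hdiv_of_BΛ_eq_one_of_divisible`.
[cite: MochizukiEtTh2009, Thm 3.7 (iv) p.80] -/
theorem isSlim_category_of_BΛ_eq_one_of_divisible (hF : PreFrobenioid.IsFrobenioid C₀.toElem)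
    (hB : ∀ (A : Dᵒᵖ) (b : T.BΛ.obj (C₀.baseOp A)),
      (∀ n : ℕ+, ∃ c : T.BΛ.obj (C₀.baseOp A), c ^ (n : ℕ) = b) → b = 1)
    (hD : IsSlim D) : IsSlim C₀.category :=
  C₀.isSlim_category_of_isFrobenioid hF (C₀.hdiv_of_BΛ_eq_one_of_divisible hF hB) hD

/-- **[EtTh] Thm. 3.7 (iv) AS TYPED** (the named `Prop` `C₀.Thm37_iv`) ⟸ {`hF`, «`B₀^Λ(Y_A)` has no non-trivial
infinitely divisible element»} — for EVERY monoid type (the `Λ`-casing antecedent is not used).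
[cite: MochizukiEtTh2009, Thm 3.7 (iv) p.80] -/
theorem thm37_iv_of_BΛ_eq_one_of_divisible (hF : PreFrobenioid.IsFrobenioid C₀.toElem)
    (hB : ∀ (A : Dᵒᵖ) (b : T.BΛ.obj (C₀.baseOp A)),
      (∀ n : ℕ+, ∃ c : T.BΛ.obj (C₀.baseOp A), c ^ (n : ℕ) = b) → b = 1) :
    C₀.Thm37_iv :=
  C₀.thm37_iv_of_isFrobenioid hF (C₀.hdiv_of_BΛ_eq_one_of_divisible hF hB)

end General

section TreeVocab

variable {D₀ : Type u₀} [Category.{v₀} D₀] {V : FrdIMonoidStub.{w}}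
  {T : RealifiedDivisorMonoids (D₀ := D₀) V} {D : Type u} [Category.{v} D]
  {IsRational IsStrictlyRational : (Dᵒᵖ ⥤ CommMonCat.{w}) → Prop}
  (C₀ : TemperedFrobenioid T D (treeCatVocab D IsRational IsStrictlyRational))

/-- **The node AS TYPED at the canonical category vocabulary** modulo {`hBmon` («`B` is a monoid on `D`», whence [FrdI]
Thm. 5.2 (ii)), «`B₀^Λ(Y_A)` has no non-trivial infinitely divisible element»}. [cite: MochizukiEtTh2009, Thm 3.7 (iv) p.80] -/
theorem thm37_iv_treeCatVocab_of_BΛ_eq_one_of_divisible (hBmon : IsMonoidOn C₀.ratFnFunctor)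
    (hB : ∀ (A : Dᵒᵖ) (b : T.BΛ.obj (C₀.baseOp A)),
      (∀ n : ℕ+, ∃ c : T.BΛ.obj (C₀.baseOp A), c ^ (n : ℕ) = b) → b = 1) :
    C₀.Thm37_iv :=
  C₀.thm37_iv_treeCatVocab_of_isMonoidOn hBmon
    (C₀.hdiv_of_BΛ_eq_one_of_divisible (C₀.isFrobenioid_treeCatVocab_of_isMonoidOn hBmon) hB)

end TreeVocab

end TemperedFrobenioid

namespace LogDivisorModel.GaloisAction

variable {Z : LogDivisorModel.{u}} {G : Type u} [Group G] (A : Z.GaloisAction G) (S : Action (Type u) G)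

/-- **Prop. 3.2 (iii) for `B₀(S)`**: a `G`-equivariant family of log-meromorphic functions `b : S → Mero(Z_∞)` admitting
an `N`-th root in `B₀(S)` for every `N ≥ 1` is trivial — pointwise by Prop. 3.2 (iii)
(`LogDivisorModel.eq_one_of_forall_exists_pow_eq`). [cite: MochizukiEtTh2009, Prop 3.2 (iii) p.70] -/
theorem bZero_eq_one_of_forall_exists_pow_eq (b : A.bZero S)
    (h : ∀ N : ℕ+, ∃ c : A.bZero S, c ^ (N : ℕ) = b) : b = 1 := by
  refine Subtype.ext (funext fun s => Z.eq_one_of_forall_exists_pow_eq (b.1 s) fun N => ?_)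
  obtain ⟨c, hc⟩ := h N
  exact ⟨c.1 s, by simpa only [Subgroup.coe_pow, Pi.pow_apply] using congrArg (fun x : A.bZero S => x.1 s) hc⟩

end LogDivisorModel.GaloisAction

namespace DivisorMonoids

open LogDivisorModel.GaloisAction

variable {Z : LogDivisorModel.{u}} {G : Type u} [Group G] (A : Z.GaloisAction G) (hZ : Z.CuspLaws)

/-- **Prop. 3.2 (iii) for `B₀` of the Def. 3.3 (iii) data of the CONNECTED coverings** (`ofGaloisActionConnected`,
print's `D₀`): no non-trivial infinitely divisible element of `B₀(Y)`. [cite: MochizukiEtTh2009, Prop 3.2 (iii) p.70] -/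
theorem ofGaloisActionConnected_B₀_eq_one_of_forall_exists_pow_eq (Y : ((isConnectedGSet (G := G)).FullSubcategory)ᵒᵖ)
    (b : (ofGaloisActionConnected A hZ).B₀.obj Y)
    (h : ∀ N : ℕ+, ∃ c : (ofGaloisActionConnected A hZ).B₀.obj Y, c ^ (N : ℕ) = b) : b = 1 :=
  A.bZero_eq_one_of_forall_exists_pow_eq Y.unop.obj b h

end DivisorMonoids

namespace TemperedFrobenioid

open LogDivisorModel.GaloisAction

section StrongZAnyBase

variable {Z : LogDivisorModel.{u}} {G : Type u} [Group G] (A : Z.GaloisAction G) (hZ : Z.CuspLaws)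
  (hpf : ∀ Y : ((isConnectedGSet (G := G)).FullSubcategory)ᵒᵖ,
    IsPerfFactorial ((DivisorMonoids.ofGaloisActionConnected A hZ).Φ₀.obj Y))
  {D : Type u'} [Category.{v'} D] {VD : FrdICatStub.{u', v', u} D}
  (C₁ : TemperedFrobenioid (RealifiedDivisorMonoids.ofRlfZ (DivisorMonoids.ofGaloisActionConnected A hZ) hpf) D VD)

/-- **Condition (b) of [FrdI] Prop. 1.13 (iii)**, monoid type `ℤ`, strong constructed data of the connected coverings,
ANY base, ANY vocabulary ⟸ `hF` only (`B₀^ℤ := B₀`, Prop. 3.2 (iii)). [cite: MochizukiEtTh2009, Thm 3.7 (iv) p.80] -/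
theorem hdiv_ofRlfZ_ofGaloisActionConnected (hF : PreFrobenioid.IsFrobenioid C₁.toElem) :
    ∀ (X : C₁.category) (α : Aut X), α ∈ PreFrobenioid.unitsSubgroup C₁.toElem X →
      (∀ n : ℕ+, ∃ β : Aut X, β ∈ PreFrobenioid.unitsSubgroup C₁.toElem X ∧ β ^ (n : ℕ) = α) → α = 1 :=
  C₁.hdiv_of_BΛ_eq_one_of_divisible hF fun B b h =>
    DivisorMonoids.ofGaloisActionConnected_B₀_eq_one_of_forall_exists_pow_eq A hZ (C₁.baseOp B) b h

/-- **[EtTh] Thm. 3.7 (iv) AS TYPED, monoid type `ℤ`, strong constructed data of the connected coverings, ANY base,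
ANY vocabulary ⟸ `hF` ([FrdI] Thm. 5.2 (ii)) ONLY** — no `hP34`. [cite: MochizukiEtTh2009, Thm 3.7 (iv) p.80] -/
theorem thm37_iv_ofRlfZ_ofGaloisActionConnected (hF : PreFrobenioid.IsFrobenioid C₁.toElem) : C₁.Thm37_iv :=
  C₁.thm37_iv_of_isFrobenioid hF (hdiv_ofRlfZ_ofGaloisActionConnected A hZ hpf C₁ hF)

end StrongZAnyBase

section StrongZTreeVocab

variable {Z : LogDivisorModel.{u}} {G : Type u} [Group G] (A : Z.GaloisAction G) (hZ : Z.CuspLaws)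
  (hpf : ∀ Y : ((isConnectedGSet (G := G)).FullSubcategory)ᵒᵖ,
    IsPerfFactorial ((DivisorMonoids.ofGaloisActionConnected A hZ).Φ₀.obj Y))
  {D : Type u'} [Category.{v'} D] {IsRational IsStrictlyRational : (Dᵒᵖ ⥤ CommMonCat.{u}) → Prop}
  (C₁ : TemperedFrobenioid (RealifiedDivisorMonoids.ofRlfZ (DivisorMonoids.ofGaloisActionConnected A hZ) hpf) D
    (treeCatVocab D IsRational IsStrictlyRational))

/-- **The node AS TYPED at `treeCatVocab`, monoid type `ℤ`, strong constructed data, ANY base ⟸ `hBmon` ONLY.**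
[cite: MochizukiEtTh2009, Thm 3.7 (iv) p.80] -/
theorem thm37_iv_ofRlfZ_ofGaloisActionConnected_treeCatVocab (hBmon : IsMonoidOn C₁.ratFnFunctor) : C₁.Thm37_iv :=
  thm37_iv_ofRlfZ_ofGaloisActionConnected A hZ hpf C₁ (C₁.isFrobenioid_treeCatVocab_of_isMonoidOn hBmon)

/-- **The node AS TYPED at `treeCatVocab`, monoid type `ℤ`, strong constructed data, ANY base of FSM-type — NO binder
beyond «`D` of FSM-type»** ([FrdI] Def. 1.1 (ii)(b); «`B` monoid on `D`» is then abc-iut-w5-d179's theorem).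
[cite: MochizukiEtTh2009, Thm 3.7 (iv) p.80] -/
theorem thm37_iv_ofRlfZ_ofGaloisActionConnected_of_isOfFSMType (hD : IsOfFSMType D) : C₁.Thm37_iv :=
  thm37_iv_ofRlfZ_ofGaloisActionConnected A hZ hpf C₁
    (C₁.isFrobenioid_of_isOfFSMType (DivisorMonoids.ofGaloisActionConnected_ofRlfZ_hBinj A hZ hpf) hD)

end StrongZTreeVocab

section StrongZGenuineBase

variable {Z : LogDivisorModel.{u}} {G : Type u} [Group G] (A : Z.GaloisAction G) (hZ : Z.CuspLaws)
  (hpf : ∀ Y : ((isConnectedGSet (G := G)).FullSubcategory)ᵒᵖ,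
    IsPerfFactorial ((DivisorMonoids.ofGaloisActionConnected A hZ).Φ₀.obj Y))
  {P : Type v} [Group P] [TopologicalSpace P]
  {IsRational IsStrictlyRational : ((ConnectedPart (BTemp P))ᵒᵖ ⥤ CommMonCat.{u}) → Prop}
  (C₁ : TemperedFrobenioid (RealifiedDivisorMonoids.ofRlfZ (DivisorMonoids.ofGaloisActionConnected A hZ) hpf)
    (ConnectedPart (BTemp P)) (treeCatVocab (ConnectedPart (BTemp P)) IsRational IsStrictlyRational))

/-- **[EtTh] Thm. 3.7 (iv) AS TYPED (`Thm37_iv`) with NO binder**: monoid type `ℤ`, strong constructed data of the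
connected coverings, genuine base `D = B^temp(Π)⁰`, any topological group `Π` («`C` Frobenioid» unconditional there,
abc-iut-w5-d179; condition (b) := Prop. 3.2 (iii)). [cite: MochizukiEtTh2009, Thm 3.7 (iv) p.80] -/
theorem thm37_iv_ofRlfZ_ofGaloisActionConnected_connectedPart_bTemp :
    Literature.AnabelianGeometry.EtaleTheta.TemperedFrobenioid.Thm37_iv
      (T := RealifiedDivisorMonoids.ofRlfZ (DivisorMonoids.ofGaloisActionConnected A hZ) hpf) C₁ :=
  thm37_iv_ofRlfZ_ofGaloisActionConnected A hZ hpf C₁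
    (isFrobenioid_ofRlfZ_ofGaloisActionConnected_connectedPart_bTemp A hZ hpf C₁)

/-- **[EtTh] Thm. 3.7 (iv), «`C` is slim», monoid type `ℤ`, strong constructed data, genuine base ⇐ {`Π` tempered,
`Π` temp-slim} ONLY** («`D` slim» := [SemiAnbd] Rmk. 3.4.1 `isSlim_connectedPart_bTemp`; the `hP34` of
`isOfUnitProfiniteType_and_isSlim_ofRlfZ_…_connectedPart_bTemp` is not needed). [cite: MochizukiEtTh2009, Thm 3.7 (iv) p.80] -/
theorem isSlim_category_ofRlfZ_ofGaloisActionConnected_connectedPart_bTemp [IsTopologicalGroup P]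
    (hG : IsTempered P) (hS : IsSlimGroup P) : IsSlim C₁.category :=
  thm37_iv_ofRlfZ_ofGaloisActionConnected_connectedPart_bTemp A hZ hpf C₁ (isSlim_connectedPart_bTemp hG hS)
    (Or.inl rfl)

/-- **[EtTh] Thm. 3.7 (iv) as printed, «`C` is slim», at `D = B^temp(Π^tp_X)⁰`, monoid type `ℤ`, strong constructed
data of the connected coverings — UNCONDITIONAL** ([SemiAnbd] Ex. 3.10 `TemperedArithmeticGroup.isSlim_connectedPart`).
[cite: MochizukiEtTh2009, Thm 3.7 (iv) p.80] -/
theorem isSlim_category_ofRlfZ_ofGaloisActionConnected_of_temperedArithmeticGroup {K : Type v} [Field K]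
    (X : TemperedArithmeticGroup.{v} K)
    {IsRational' IsStrictlyRational' : ((ConnectedPart (BTemp X.Pi))ᵒᵖ ⥤ CommMonCat.{u}) → Prop}
    (C₂ : TemperedFrobenioid (RealifiedDivisorMonoids.ofRlfZ (DivisorMonoids.ofGaloisActionConnected A hZ) hpf)
      (ConnectedPart (BTemp X.Pi)) (treeCatVocab (ConnectedPart (BTemp X.Pi)) IsRational' IsStrictlyRational')) :
    IsSlim C₂.category :=
  thm37_iv_ofRlfZ_ofGaloisActionConnected_connectedPart_bTemp A hZ hpf C₂ X.isSlim_connectedPart (Or.inl rfl)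

end StrongZGenuineBase

section WeakZAnyBase

variable {Z : LogDivisorModel.{u}} {G : Type u} [Group G] (A : Z.GaloisAction G) (hZ : Z.CuspLaws)
  (hpf : ∀ Y : ((isConnectedGSet (G := G)).FullSubcategory)ᵒᵖ,
    IsPerfFactorialCof ((DivisorMonoids.ofGaloisActionConnected A hZ).Φ₀.obj Y))
  {D : Type u'} [Category.{v'} D] {VD : FrdICatStub.{u', v', u} D}
  (C₁ : TemperedFrobenioid (RealifiedDivisorMonoids.ofRlfZWeak (DivisorMonoids.ofGaloisActionConnected A hZ) hpf) D VD)

/-- **Condition (b) of [FrdI] Prop. 1.13 (iii)**, monoid type `ℤ`, WEAK constructed data of the connected coverings,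
ANY base, ANY vocabulary ⟸ `hF` only. [cite: MochizukiEtTh2009, Thm 3.7 (iv) p.80] -/
theorem hdiv_ofRlfZWeak_ofGaloisActionConnected (hF : PreFrobenioid.IsFrobenioid C₁.toElem) :
    ∀ (X : C₁.category) (α : Aut X), α ∈ PreFrobenioid.unitsSubgroup C₁.toElem X →
      (∀ n : ℕ+, ∃ β : Aut X, β ∈ PreFrobenioid.unitsSubgroup C₁.toElem X ∧ β ^ (n : ℕ) = α) → α = 1 :=
  C₁.hdiv_of_BΛ_eq_one_of_divisible hF fun B b h =>
    DivisorMonoids.ofGaloisActionConnected_B₀_eq_one_of_forall_exists_pow_eq A hZ (C₁.baseOp B) b h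

/-- **[EtTh] Thm. 3.7 (iv) AS TYPED, monoid type `ℤ`, weak constructed data, ANY base, ANY vocabulary ⟸ `hF` ONLY.**
[cite: MochizukiEtTh2009, Thm 3.7 (iv) p.80] -/
theorem thm37_iv_ofRlfZWeak_ofGaloisActionConnected (hF : PreFrobenioid.IsFrobenioid C₁.toElem) : C₁.Thm37_iv :=
  C₁.thm37_iv_of_isFrobenioid hF (hdiv_ofRlfZWeak_ofGaloisActionConnected A hZ hpf C₁ hF)

end WeakZAnyBase

section WeakZTreeVocab

variable {Z : LogDivisorModel.{u}} {G : Type u} [Group G] (A : Z.GaloisAction G) (hZ : Z.CuspLaws)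
  (hpf : ∀ Y : ((isConnectedGSet (G := G)).FullSubcategory)ᵒᵖ,
    IsPerfFactorialCof ((DivisorMonoids.ofGaloisActionConnected A hZ).Φ₀.obj Y))
  {D : Type u'} [Category.{v'} D] {IsRational IsStrictlyRational : (Dᵒᵖ ⥤ CommMonCat.{u}) → Prop}
  (C₁ : TemperedFrobenioid (RealifiedDivisorMonoids.ofRlfZWeak (DivisorMonoids.ofGaloisActionConnected A hZ) hpf) D
    (treeCatVocab D IsRational IsStrictlyRational))

/-- **The node AS TYPED at `treeCatVocab`, monoid type `ℤ`, weak constructed data, ANY base ⟸ `hBmon` ONLY.**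
[cite: MochizukiEtTh2009, Thm 3.7 (iv) p.80] -/
theorem thm37_iv_ofRlfZWeak_ofGaloisActionConnected_treeCatVocab (hBmon : IsMonoidOn C₁.ratFnFunctor) :
    C₁.Thm37_iv :=
  thm37_iv_ofRlfZWeak_ofGaloisActionConnected A hZ hpf C₁ (C₁.isFrobenioid_treeCatVocab_of_isMonoidOn hBmon)

/-- **The node AS TYPED at `treeCatVocab`, monoid type `ℤ`, weak constructed data, ANY base of FSM-type — NO binder
beyond «`D` of FSM-type».** [cite: MochizukiEtTh2009, Thm 3.7 (iv) p.80] -/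
theorem thm37_iv_ofRlfZWeak_ofGaloisActionConnected_of_isOfFSMType (hD : IsOfFSMType D) : C₁.Thm37_iv :=
  thm37_iv_ofRlfZWeak_ofGaloisActionConnected A hZ hpf C₁
    (isFrobenioid_ofRlfZWeak_ofGaloisActionConnected_of_isOfFSMType A hZ hpf C₁ hD)

end WeakZTreeVocab

section WeakZGenuineBase

variable {Z : LogDivisorModel.{u}} {G : Type u} [Group G] (A : Z.GaloisAction G) (hZ : Z.CuspLaws)
  (hpf : ∀ Y : ((isConnectedGSet (G := G)).FullSubcategory)ᵒᵖ,
    IsPerfFactorialCof ((DivisorMonoids.ofGaloisActionConnected A hZ).Φ₀.obj Y))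
  {P : Type v} [Group P] [TopologicalSpace P]
  {IsRational IsStrictlyRational : ((ConnectedPart (BTemp P))ᵒᵖ ⥤ CommMonCat.{u}) → Prop}
  (C₁ : TemperedFrobenioid (RealifiedDivisorMonoids.ofRlfZWeak (DivisorMonoids.ofGaloisActionConnected A hZ) hpf)
    (ConnectedPart (BTemp P)) (treeCatVocab (ConnectedPart (BTemp P)) IsRational IsStrictlyRational))

/-- **[EtTh] Thm. 3.7 (iv) AS TYPED (`Thm37_iv`) with NO binder**: monoid type `ℤ`, weak constructed data of the
connected coverings, genuine base `D = B^temp(Π)⁰`, any topological group `Π`. [cite: MochizukiEtTh2009, Thm 3.7 (iv) p.80] -/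
theorem thm37_iv_ofRlfZWeak_ofGaloisActionConnected_connectedPart_bTemp :
    Literature.AnabelianGeometry.EtaleTheta.TemperedFrobenioid.Thm37_iv
      (T := RealifiedDivisorMonoids.ofRlfZWeak (DivisorMonoids.ofGaloisActionConnected A hZ) hpf) C₁ :=
  thm37_iv_ofRlfZWeak_ofGaloisActionConnected A hZ hpf C₁
    (isFrobenioid_ofRlfZWeak_ofGaloisActionConnected_connectedPart_bTemp A hZ hpf C₁)

/-- **[EtTh] Thm. 3.7 (iv), «`C` is slim», monoid type `ℤ`, weak constructed data, genuine base ⇐ {`Π` tempered,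
`Π` temp-slim} ONLY** (the `hP34` of `isOfUnitProfiniteType_and_isSlim_ofRlfZWeak_…_connectedPart_bTemp` is not
needed). [cite: MochizukiEtTh2009, Thm 3.7 (iv) p.80] -/
theorem isSlim_category_ofRlfZWeak_ofGaloisActionConnected_connectedPart_bTemp [IsTopologicalGroup P]
    (hG : IsTempered P) (hS : IsSlimGroup P) : IsSlim C₁.category :=
  thm37_iv_ofRlfZWeak_ofGaloisActionConnected_connectedPart_bTemp A hZ hpf C₁ (isSlim_connectedPart_bTemp hG hS)
    (Or.inl rfl)

/-- **[EtTh] Thm. 3.7 (iv) as printed, «`C` is slim», at `D = B^temp(Π^tp_X)⁰`, monoid type `ℤ`, weak constructed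
data of the connected coverings — UNCONDITIONAL** (e.g. `hpf := DivisorMonoids.ofGaloisActionConnected_isPerfFactorialCof A hZ`).
[cite: MochizukiEtTh2009, Thm 3.7 (iv) p.80] -/
theorem isSlim_category_ofRlfZWeak_ofGaloisActionConnected_of_temperedArithmeticGroup {K : Type v} [Field K]
    (X : TemperedArithmeticGroup.{v} K)
    {IsRational' IsStrictlyRational' : ((ConnectedPart (BTemp X.Pi))ᵒᵖ ⥤ CommMonCat.{u}) → Prop}
    (C₂ : TemperedFrobenioid (RealifiedDivisorMonoids.ofRlfZWeak (DivisorMonoids.ofGaloisActionConnected A hZ) hpf)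
      (ConnectedPart (BTemp X.Pi)) (treeCatVocab (ConnectedPart (BTemp X.Pi)) IsRational' IsStrictlyRational')) :
    IsSlim C₂.category :=
  thm37_iv_ofRlfZWeak_ofGaloisActionConnected_connectedPart_bTemp A hZ hpf C₂ X.isSlim_connectedPart (Or.inl rfl)

end WeakZGenuineBase

section StrongRGenuineBase

variable {Z : LogDivisorModel.{u}} {G : Type u} [Group G] (A : Z.GaloisAction G) (hZ : Z.CuspLaws)
  (hpf : ∀ Y : ((isConnectedGSet (G := G)).FullSubcategory)ᵒᵖ,
    IsPerfFactorial ((DivisorMonoids.ofGaloisActionConnected A hZ).Φ₀.obj Y))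
  {P : Type v} [Group P] [TopologicalSpace P]
  {IsRational IsStrictlyRational : ((ConnectedPart (BTemp P))ᵒᵖ ⥤ CommMonCat.{u}) → Prop}
  (C₀ : TemperedFrobenioid (RealifiedDivisorMonoids.ofRlfR (DivisorMonoids.ofGaloisActionConnected A hZ) hpf)
    (ConnectedPart (BTemp P)) (treeCatVocab (ConnectedPart (BTemp P)) IsRational IsStrictlyRational))

/-- **[EtTh] Thm. 3.7 (iv) AS TYPED with NO binder**: monoid type `ℝ`, strong constructed data of the connected
coverings, genuine base (abc-iut-L6-t13's `thm37_iv_ofRlfR` ∘ abc-iut-w5-d179's unconditional «`C` Frobenioid»).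
[cite: MochizukiEtTh2009, Thm 3.7 (iv) p.80] -/
theorem thm37_iv_ofRlfR_ofGaloisActionConnected_connectedPart_bTemp :
    Literature.AnabelianGeometry.EtaleTheta.TemperedFrobenioid.Thm37_iv
      (T := RealifiedDivisorMonoids.ofRlfR (DivisorMonoids.ofGaloisActionConnected A hZ) hpf) C₀ :=
  C₀.thm37_iv_ofRlfR (DivisorMonoids.ofGaloisActionConnected A hZ) hpf
    (isFrobenioid_ofRlfR_ofGaloisActionConnected_connectedPart_bTemp A hZ hpf C₀)

end StrongRGenuineBase

section WeakRGenuineBase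

variable {Z : LogDivisorModel.{u}} {G : Type u} [Group G] (A : Z.GaloisAction G) (hZ : Z.CuspLaws)
  (hpf : ∀ Y : ((isConnectedGSet (G := G)).FullSubcategory)ᵒᵖ,
    IsPerfFactorialCof ((DivisorMonoids.ofGaloisActionConnected A hZ).Φ₀.obj Y))
  {P : Type v} [Group P] [TopologicalSpace P]
  {IsRational IsStrictlyRational : ((ConnectedPart (BTemp P))ᵒᵖ ⥤ CommMonCat.{u}) → Prop}
  (C₀ : TemperedFrobenioid (RealifiedDivisorMonoids.ofRlfRWeak (DivisorMonoids.ofGaloisActionConnected A hZ) hpf)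
    (ConnectedPart (BTemp P)) (treeCatVocab (ConnectedPart (BTemp P)) IsRational IsStrictlyRational))

/-- **[EtTh] Thm. 3.7 (iv) AS TYPED with NO binder**: monoid type `ℝ`, weak constructed data of the connected
coverings, genuine base (abc-iut-L2-t6's `thm37_iv_ofRlfRWeak` ∘ abc-iut-w6-d048's unconditional «`C` Frobenioid»).
[cite: MochizukiEtTh2009, Thm 3.7 (iv) p.80] -/
theorem thm37_iv_ofRlfRWeak_ofGaloisActionConnected_connectedPart_bTemp :
    Literature.AnabelianGeometry.EtaleTheta.TemperedFrobenioid.Thm37_iv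
      (T := RealifiedDivisorMonoids.ofRlfRWeak (DivisorMonoids.ofGaloisActionConnected A hZ) hpf) C₀ :=
  thm37_iv_ofRlfRWeak (DivisorMonoids.ofGaloisActionConnected A hZ) hpf C₀
    (isFrobenioid_ofRlfRWeak_ofGaloisActionConnected_connectedPart_bTemp A hZ hpf C₀)

end WeakRGenuineBase

end TemperedFrobenioid

end Literature.AnabelianGeometry.EtaleTheta

end
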